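import Summits.Parity.BatemanHorn.Theorems.SoloInformedHooleyMeanProfile

/-!
# The trapezoid method under the scale profile: the uniform block bound

Informed soloist `solo-Parity-informed` (session 144), conjunct `BatemanHorn`, the `d ≥ 3` rung BELOW the parity
wall.  The block estimate `norm_trapBlockFirst_le` with the parameter choices of `SoloInformedTrapezoidUniform`,
the split frequency `H₀ = min(H, ⌊E^σ⌋)` and the majorants supplied by the scale profile
(`SoloInformedHooleyMeanProfile`) gives, for `X₁ = X₀ + D ≤ E ≤ E' ≤ 2E`, `E ≥ E₀(ε)`,
`‖Z(E,E']‖ ≤ K·[ε(X₁D + X₁E^{1−σ} + X₁DE^{1−σ−2/d}) + X₁DE^{σ−η} + (2 + log E)(X₁E^{1−η} + X₁DE^{1−η−2/d})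
  + E^{2−θ} + DE^{2−θ−2/d}]` with `K = K(g, Δ, C)` independent of `ε` (`exists_trapBlock_profile`).
-/

namespace Summit.Parity.BatemanHorn.Theorems

open Finset Polynomial
open Literature.NumberTheory.Sieve (polyRootCountMod)

set_option maxHeartbeats 1600000 in
/-- **Uniform block bound under the scale profile.**  For `g` irreducible of degree `d ≥ 2`, `Δ > 0`,
`0 ≤ σ ≤ θ ≤ 1`, and the scale profile with constant `C` and exponent `η`: there are `K, x₁` (independent of `ε`)
such that for every `ε > 0` there is `E₀` with
`‖Z(E,E']‖ ≤ K·[ε(X₁D + X₁E^{1−σ} + X₁DE^{1−σ−2/d}) + X₁DE^{σ−η} + (2+log E)(X₁E^{1−η} + X₁DE^{1−η−2/d})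
  + E^{2−θ} + DE^{2−θ−2/d}]`
for `X₁ = X₀ + D ≥ x₁`, `D ≤ X₀`, `X₁ ≤ E`, `E₀ ≤ E ≤ E' ≤ 2E`. [this work] -/
theorem exists_trapBlock_profile {g : ℤ[X]} (hirr : Irreducible g) (hdeg : 2 ≤ g.natDegree) {Δ : ℝ}
    (hΔ : 0 < Δ) {C θ η σ : ℝ} (hC0 : 0 ≤ C) (hθ1 : θ ≤ 1) (hσ0 : 0 ≤ σ) (hσθ : σ ≤ θ)
    (hP : ∀ ε : ℝ, 0 < ε → ∃ E₀ : ℕ, ∀ E₁ E₁' H₁ : ℕ, E₀ ≤ E₁ → 1 ≤ E₁ → E₁ ≤ E₁' → E₁' ≤ 2 * E₁ →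
      (H₁ : ℝ) ≤ (E₁ : ℝ) ^ θ →
      ∑ h ∈ Icc 1 H₁, (‖∑ e ∈ Ioc E₁ E₁', hooleySum g e h‖ + ‖∑ e ∈ Ioc E₁ E₁', hooleySum g e (-(h : ℤ))‖)
        ≤ ε * E₁ + C * H₁ * (E₁ : ℝ) ^ (1 - η)) :
    ∃ K : ℝ, ∃ x₁ : ℕ, 0 ≤ K ∧ ∀ ε : ℝ, 0 < ε → ∃ E₀ : ℕ, ∀ X₀ D E E' : ℕ, x₁ ≤ X₀ + D → D ≤ X₀ →
      X₀ + D ≤ E → E₀ ≤ E → E ≤ E' → E' ≤ 2 * E →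
      ‖∑ e ∈ Ioc E E', 1 / (e : ℂ) * ∑ h ∈ Ico 1 e, trapKernel g Δ X₀ D e h * hooleySum g e h‖
        ≤ K * (ε * ((X₀ + D : ℕ) * (D : ℝ) + (X₀ + D : ℕ) * (E : ℝ) ^ (1 - σ)
                + (X₀ + D : ℕ) * D * (E : ℝ) ^ (1 - σ - 2 / g.natDegree))
              + (X₀ + D : ℕ) * D * (E : ℝ) ^ (σ - η)
              + ((2 + Real.log E) * ((X₀ + D : ℕ) * (E : ℝ) ^ (1 - η)
                  + (X₀ + D : ℕ) * D * (E : ℝ) ^ (1 - η - 2 / g.natDegree))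
                + (E : ℝ) ^ (2 - θ) + D * (E : ℝ) ^ (2 - θ - 2 / g.natDegree))) := by
  obtain ⟨m₀, hm₀⟩ := exists_natAbs_eval_lt_succ (g := g) (by omega)
  obtain ⟨C₁, hC₁⟩ := exists_abs_log_natAbs_succ_sub_le hirr hdeg
  obtain ⟨C₂, hC₂⟩ := exists_abs_log_natAbs_second_diff_le hirr hdeg
  obtain ⟨c, hc, hcvan⟩ := exists_locWeight_eq_zero_of_pow_le hirr hdeg hΔ
  obtain ⟨e₀, he₀⟩ := exists_locWeight_zero_eq_zero hirr hdeg hΔ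
  obtain ⟨R₀, hR₀0, hR₀⟩ := exists_sum_Ioc_rootCount_div_le hirr (by omega)
  have hz : ∀ k : ℕ, g.eval (k : ℤ) ≠ 0 := eval_natCast_ne_zero_of_irreducible hirr hdeg
  have hmono : ∀ m m' : ℕ, m₀ ≤ m → m ≤ m' → (g.eval (m : ℤ)).natAbs ≤ (g.eval (m' : ℤ)).natAbs :=
    fun m m' hm hmm' => natAbs_eval_mono hm₀ hm hmm'
  have hC₁0 : 0 ≤ C₁ := by have h := hC₁ 1 le_rfl; norm_num at h; exact (abs_nonneg _).trans h
  have hC₂0 : 0 ≤ C₂ := by have h := hC₂ 1 le_rfl; norm_num at h; exact (abs_nonneg _).trans h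
  set d : ℕ := g.natDegree with hd
  have hd0 : d ≠ 0 := by omega
  set c₀ : ℝ := c ^ ((d : ℝ)⁻¹) with hc₀
  have hc₀0 : 0 < c₀ := Real.rpow_pos_of_pos hc _
  set V₀ : ℝ := 2 + C₁ / (2 * Δ) with hV₀
  set K₂ : ℝ := (C₂ + 4 * C₁) / Δ with hK₂
  have hV₀0 : 0 ≤ V₀ := by positivity
  have hK₂0 : 0 ≤ K₂ := by positivity
  have hpi := Real.pi_pos.le
  set M : ℕ := max 4 (m₀ + 2) with hM
  set xA : ℕ := ⌈(M : ℝ) ^ d / c⌉₊ + 1 with hxA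
  -- the constants of the four pieces
  set ca : ℝ := 2 + 1 / (2 * Δ) + Real.pi / 2 with hca
  set cb : ℝ := 1 + 1 / (2 * Δ) + Real.pi / 2 with hcb
  set kL : ℝ := (4 * ca + 3 * Real.pi) * (1 + C) with hkL
  set kM : ℝ := 8 * (cb + 3 * Real.pi * V₀ / 8) + (cb + 3 * Real.pi * V₀ / 8) * C + 3 * Real.pi * K₂ / c₀
    + 3 * Real.pi * K₂ * C / (8 * c₀) with hkM
  set kN : ℝ := Real.pi ^ 2 * (1 + C) with hkN
  set kT : ℝ := 4 * R₀ * V₀ + 4 * R₀ * K₂ / c₀ with hkT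
  have hca0 : 0 ≤ ca := by positivity
  have hcb0 : 0 ≤ cb := by positivity
  have hkL0 : 0 ≤ kL := by positivity
  have hkM0 : 0 ≤ kM := by positivity
  have hkN0 : 0 ≤ kN := by positivity
  have hkT0 : 0 ≤ kT := by positivity
  refine ⟨2 * (kL + kM + kN) + kT, max e₀ (max 2 xA), by positivity, ?_⟩
  intro ε hε
  obtain ⟨E₀, hE₀⟩ := hP ε hε
  refine ⟨E₀, fun X₀ D E E' hx₁ hDX hXE hE₀E hEE' hE'2 => ?_⟩
  have he₀X : e₀ ≤ X₀ + D := le_trans (le_max_left _ _) hx₁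
  have h2X : 2 ≤ X₀ + D := le_trans ((le_max_left _ _).trans (le_max_right _ _)) hx₁
  have hxAX : xA ≤ X₀ + D := le_trans ((le_max_right _ _).trans (le_max_right _ _)) hx₁
  have hE2 : 2 ≤ E := h2X.trans hXE
  have hE1 : 1 ≤ E := by omega
  have hE0 : (0 : ℝ) < E := by exact_mod_cast (show 0 < E by omega)
  have hE1r : (1 : ℝ) ≤ E := by exact_mod_cast hE1
  -- the vanishing range
  set y : ℝ := (c * (E : ℝ) ^ 2) ^ ((d : ℝ)⁻¹) with hy
  have hMy : (M : ℝ) ≤ y := by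
    have h1 : (M : ℝ) ^ d / c ≤ xA := by
      calc (M : ℝ) ^ d / c ≤ ⌈(M : ℝ) ^ d / c⌉₊ := Nat.le_ceil _
        _ ≤ xA := by rw [hxA]; push_cast; linarith
    have hxE : (xA : ℝ) ≤ E := by exact_mod_cast hxAX.trans hXE
    have h2 : (M : ℝ) ^ d ≤ c * (E : ℝ) ^ 2 := by
      rw [div_le_iff₀ hc] at h1
      calc (M : ℝ) ^ d ≤ xA * c := h1
        _ ≤ E * c := by gcongr
        _ ≤ (E : ℝ) ^ 2 * c := by gcongr; nlinarith
        _ = c * (E : ℝ) ^ 2 := mul_comm _ _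
    calc (M : ℝ) = ((M : ℝ) ^ d) ^ ((d : ℝ)⁻¹) := (Real.pow_rpow_inv_natCast (Nat.cast_nonneg _) hd0).symm
      _ ≤ y := Real.rpow_le_rpow (by positivity) h2 (by positivity)
  have hy4 : 4 ≤ y := le_trans (by exact_mod_cast le_max_left 4 (m₀ + 2)) hMy
  have hym : (m₀ : ℝ) + 2 ≤ y := le_trans (by exact_mod_cast le_max_right 4 (m₀ + 2)) hMy
  have hy0 : 0 < y := by linarith
  obtain ⟨hAm, hA1, hApow, hAy⟩ := trapRange_choice hy4 hym d
  set A : ℕ := ⌊y⌋₊ - 1 with hA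
  have hyd : y ^ d = c * (E : ℝ) ^ 2 := by rw [hy]; exact Real.rpow_inv_natCast_pow (by positivity) hd0
  have hvan : ∀ e : ℕ, E ≤ e → ∀ m : ℕ, m ≤ A + 1 → locWeight g Δ e m = 0 := by
    intro e he m hm
    rcases Nat.eq_zero_or_pos m with rfl | hm1
    · exact he₀ e (he₀X.trans (hXE.trans he))
    · apply hcvan e m hm1
      have hmA : (m : ℝ) ≤ (A : ℝ) + 1 := by exact_mod_cast hm
      have her : (E : ℝ) ≤ e := by exact_mod_cast he
      calc (m : ℝ) ^ d ≤ ((A : ℝ) + 1) ^ d := pow_le_pow_left₀ (Nat.cast_nonneg _) hmA d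
        _ ≤ y ^ d := hApow
        _ = c * (E : ℝ) ^ 2 := hyd
        _ ≤ c * (e : ℝ) ^ 2 := by gcongr
  -- the frequency cut and the split frequency
  obtain ⟨hH, hHθ, hH4, hHE⟩ := trapFreq_choice hE2 hθ1
  set H : ℕ := ⌊(E : ℝ) ^ θ⌋₊ / 4 with hHdef
  obtain ⟨hH₀H, hH₀σ, hσ4⟩ := trapSplit_choice (H := H) hE1 hσθ hH4
  set H₀ : ℕ := min H ⌊(E : ℝ) ^ σ⌋₊ with hH₀def
  have hH₀θ : (H₀ : ℝ) ≤ (E : ℝ) ^ θ := le_trans (by exact_mod_cast hH₀H) hHθ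
  -- abbreviations
  set ℓ : ℝ := 2 + Real.log E with hℓ
  set M₁ : ℝ := (E : ℝ) ^ (1 - η) with hM₁
  set M₂ : ℝ := (E : ℝ) ^ (1 - η - 2 / d) with hM₂
  set M₃ : ℝ := (E : ℝ) ^ (2 - θ) with hM₃
  set M₄ : ℝ := (E : ℝ) ^ (2 - θ - 2 / d) with hM₄
  set P₁ : ℝ := (E : ℝ) ^ (1 - σ) with hP₁
  set P₂ : ℝ := (E : ℝ) ^ (1 - σ - 2 / d) with hP₂
  set G : ℝ := (E : ℝ) ^ (σ - η) with hG
  set Eσ : ℝ := (E : ℝ) ^ σ with hEσ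
  set Eθ : ℝ := (E : ℝ) ^ θ with hEθ
  have hM₁0 : 0 ≤ M₁ := by positivity
  have hM₃0 : 0 ≤ M₃ := by positivity
  have hP₁0 : 0 ≤ P₁ := by positivity
  have hG0 : 0 ≤ G := by positivity
  have hℓ2 : 2 ≤ ℓ := by have := Real.log_natCast_nonneg E; rw [hℓ]; linarith
  -- the majorants
  set Λ₀ : ℝ := ε * E + C * Eσ * M₁ with hΛ₀
  set Λ₁ : ℝ := 8 * ε * P₁ + C * M₁ * ℓ with hΛ₁
  set Λ₂ : ℝ := ε * E + C * Eθ * M₁ with hΛ₂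
  have hΛ₀0 : 0 ≤ Λ₀ := by positivity
  have hΛ₁0 : 0 ≤ Λ₁ := by positivity
  have hΛ₂0 : 0 ≤ Λ₂ := by positivity
  have hprof : ∀ t ∈ Icc E E', ∀ H' : ℕ, (H' : ℝ) ≤ Eθ →
      ∑ h ∈ Icc 1 H', (‖∑ i ∈ Ioc E t, hooleySum g i h‖ + ‖∑ i ∈ Ioc E t, hooleySum g i (-(h : ℤ))‖)
        ≤ ε * E + C * M₁ * H' := by
    intro t ht H' hH'
    rw [mem_Icc] at ht
    have := hE₀ E t H' hE₀E hE1 ht.1 (ht.2.trans hE'2) hH'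
    linarith [this]
  have hT₀ : ∀ t ∈ Icc E E', ∑ h ∈ Icc 1 H₀,
      (‖∑ i ∈ Ioc E t, hooleySum g i h‖ + ‖∑ i ∈ Ioc E t, hooleySum g i (-(h : ℤ))‖) ≤ Λ₀ := by
    intro t ht
    refine (hprof t ht H₀ hH₀θ).trans ?_
    have : C * M₁ * H₀ ≤ C * M₁ * Eσ := mul_le_mul_of_nonneg_left hH₀σ (by positivity)
    rw [hΛ₀]; linarith
  have hT₁ : ∀ t ∈ Icc E E', ∑ h ∈ Ioc H₀ H,
      (‖∑ i ∈ Ioc E t, hooleySum g i h‖ + ‖∑ i ∈ Ioc E t, hooleySum g i (-(h : ℤ))‖) / h ≤ Λ₁ := by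
    intro t ht
    have key := sum_Ioc_div_le_of_partial_sums_le_affine
      (x := fun h => ‖∑ i ∈ Ioc E t, hooleySum g i h‖ + ‖∑ i ∈ Ioc E t, hooleySum g i (-(h : ℤ))‖)
      (fun h => by positivity) (a := ε * E) (b := C * M₁) (by positivity) (by positivity) (H₀ := H₀) (H := H)
      (fun H' hH' => hprof t ht H' (le_trans (by exact_mod_cast (mem_Icc.mp hH').2) hHθ))
    refine key.trans ?_
    have h1 : 2 * (ε * E) / ((H₀ : ℝ) + 1) ≤ 8 * ε * P₁ := by
      rw [div_le_iff₀ (by positivity)]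
      have hP₁eq : P₁ * Eσ = E := by
        rw [hP₁, hEσ, ← Real.rpow_add hE0, sub_add_cancel, Real.rpow_one]
      have : 2 * (ε * E) = 2 * ε * P₁ * Eσ := by rw [mul_assoc (2 * ε), hP₁eq]; ring
      rw [this]
      have := mul_le_mul_of_nonneg_left hσ4 (by positivity : 0 ≤ 2 * ε * P₁)
      linarith
    have h2 : C * M₁ * (2 + Real.log H) ≤ C * M₁ * ℓ := by
      apply mul_le_mul_of_nonneg_left _ (by positivity)
      rw [hℓ]; linarith [log_natCast_le_of_le hHE]
    linarith
  have hT₂ : ∀ t ∈ Icc E E', ∑ h ∈ Ioc H₀ H,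
      (‖∑ i ∈ Ioc E t, hooleySum g i h‖ + ‖∑ i ∈ Ioc E t, hooleySum g i (-(h : ℤ))‖) ≤ Λ₂ := by
    intro t ht
    calc _ ≤ ∑ h ∈ Icc 1 H,
          (‖∑ i ∈ Ioc E t, hooleySum g i h‖ + ‖∑ i ∈ Ioc E t, hooleySum g i (-(h : ℤ))‖) := by
          refine sum_le_sum_of_subset_of_nonneg (fun h hh => ?_) fun h _ _ => by positivity
          rw [mem_Ioc] at hh; rw [mem_Icc]; omega
      _ ≤ ε * E + C * M₁ * H := hprof t ht H hHθ
      _ ≤ Λ₂ := by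
          have : C * M₁ * H ≤ C * M₁ * Eθ := mul_le_mul_of_nonneg_left hHθ (by positivity)
          rw [hΛ₂]; linarith
  have hblock := norm_trapBlockFirst_le g hΔ X₀ D hz hAm hA1 hmono hC₁ hC₂ hE1 hEE' hE'2 hH₀H hH hvan
    hΛ₀0 hΛ₁0 hΛ₂0 hT₀ hT₁ hT₂
  refine hblock.trans ?_
  clear hblock hT₀ hT₁ hT₂ hprof hE₀ hcvan hvan hC₁ hC₂ hmono hm₀ he₀ hz
  -- more abbreviations
  set N : ℝ := ((X₀ + D + 2 : ℕ) : ℝ) with hN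
  set N' : ℝ := ((X₀ + D + 3 : ℕ) : ℝ) with hN'
  set V : ℝ := 2 + D * C₁ / (2 * Δ * ((X₀ : ℝ) + 1)) + D * ((C₂ + 4 * C₁) / (2 * Δ * A)) with hV
  set Vb : ℝ := V₀ + D * K₂ / y with hVb
  set R : ℝ := ∑ e ∈ Ioc E E', (polyRootCountMod ![g] e : ℝ) / e with hR
  set X₁ : ℝ := ((X₀ + D : ℕ) : ℝ) with hX₁
  have hX₁E : X₁ ≤ E := by rw [hX₁]; exact_mod_cast hXE
  have hX₁2 : 2 ≤ X₁ := by rw [hX₁]; exact_mod_cast h2X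
  have hD0 : (0 : ℝ) ≤ D := Nat.cast_nonneg D
  have hDX₁ : (D : ℝ) ≤ X₁ := by rw [hX₁]; push_cast; linarith [(Nat.cast_nonneg X₀ : (0 : ℝ) ≤ X₀)]
  have hX₁0 : 0 ≤ X₁ := by linarith
  have hN3 : N ≤ 3 * X₁ := by rw [hN, hX₁]; push_cast; rw [hX₁] at hX₁2; push_cast at hX₁2; linarith
  have hN'4 : N' ≤ 4 * X₁ := by rw [hN', hX₁]; push_cast; rw [hX₁] at hX₁2; push_cast at hX₁2; linarith
  have hN0 : 0 ≤ N := Nat.cast_nonneg _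
  have hN'0 : 0 ≤ N' := Nat.cast_nonneg _
  have hVb0 : 0 ≤ Vb := by positivity
  -- `y = c₀ E^{2/d}` and the exponent identities
  have hyeq : y = c₀ * (E : ℝ) ^ ((2 : ℝ) / d) := by
    rw [hy, hc₀, Real.mul_rpow hc.le (by positivity), div_eq_mul_inv,
      show ((E : ℝ) ^ 2) = (E : ℝ) ^ ((2 : ℕ) : ℝ) from (Real.rpow_natCast _ 2).symm,
      ← Real.rpow_mul hE0.le]
    norm_num
  have hy1 : M₁ / y = M₂ / c₀ := by
    have hsplit : M₁ = M₂ * (E : ℝ) ^ ((2 : ℝ) / d) := by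
      rw [hM₁, hM₂, ← Real.rpow_add hE0, sub_add_cancel]
    rw [div_eq_div_iff hy0.ne' hc₀0.ne', hsplit, hyeq]; ring
  have hy3 : M₃ / y = M₄ / c₀ := by
    have hsplit : M₃ = M₄ * (E : ℝ) ^ ((2 : ℝ) / d) := by
      rw [hM₃, hM₄, ← Real.rpow_add hE0, sub_add_cancel]
    rw [div_eq_div_iff hy0.ne' hc₀0.ne', hsplit, hyeq]; ring
  have hyP : P₁ / y = P₂ / c₀ := by
    have hsplit : P₁ = P₂ * (E : ℝ) ^ ((2 : ℝ) / d) := by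
      rw [hP₁, hP₂, ← Real.rpow_add hE0, sub_add_cancel]
    rw [div_eq_div_iff hy0.ne' hc₀0.ne', hsplit, hyeq]; ring
  have hσM : Eσ * M₁ = G * E := by
    rw [show G * (E : ℝ) = G * (E : ℝ) ^ (1 : ℝ) by rw [Real.rpow_one], hEσ, hM₁, hG, ← Real.rpow_add hE0,
      ← Real.rpow_add hE0]
    ring_nf
  have hθM : Eθ * M₁ ≤ G * (E : ℝ) ^ 2 := by
    rw [hEθ, hM₁, hG, ← Real.rpow_add hE0,
      show ((E : ℝ) ^ 2) = (E : ℝ) ^ ((2 : ℕ) : ℝ) from (Real.rpow_natCast _ 2).symm, ← Real.rpow_add hE0]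
    exact Real.rpow_le_rpow_of_exponent_le hE1r (by push_cast; linarith)
  -- `V ≤ Vb`
  have hVVb : V ≤ Vb := by
    have h1 : D * C₁ / (2 * Δ * ((X₀ : ℝ) + 1)) ≤ C₁ / (2 * Δ) := by
      rw [div_le_div_iff₀ (by positivity) (by positivity)]
      have : (D : ℝ) ≤ X₀ := by exact_mod_cast hDX
      have : 0 ≤ C₁ * (2 * Δ) * ((X₀ : ℝ) + 1 - D) := by
        exact mul_nonneg (by positivity) (by linarith)
      linarith
    have h2 : (D : ℝ) * ((C₂ + 4 * C₁) / (2 * Δ * A)) ≤ D * K₂ / y := by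
      have hA0 : (0 : ℝ) < A := by exact_mod_cast (show 0 < A by omega)
      rw [mul_div_assoc]
      apply mul_le_mul_of_nonneg_left _ (Nat.cast_nonneg D)
      rw [hK₂, div_div]
      have hyA : Δ * y ≤ 2 * Δ * A := by
        have := mul_le_mul_of_nonneg_left hAy hΔ.le; linarith
      exact div_le_div_of_nonneg_left (by positivity) (by positivity) hyA
    rw [hV, hVb, hV₀]; linarith [h1, h2]
  have hV0 : 0 ≤ V := by positivity
  -- the target sum of monomials
  set S : ℝ := ε * (X₁ * D + X₁ * P₁ + X₁ * D * P₂) + X₁ * D * G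
      + (ℓ * (X₁ * M₁ + X₁ * D * M₂) + M₃ + D * M₄) with hS
  have hℓ0 : 0 ≤ ℓ := by linarith
  have hM₂0 : 0 ≤ M₂ := by positivity
  have hM₄0 : 0 ≤ M₄ := by positivity
  have hP₂0 : 0 ≤ P₂ := by positivity
  have n1 : 0 ≤ ε * (X₁ * D) := by positivity
  have n2 : 0 ≤ ε * (X₁ * P₁) := by positivity
  have n3 : 0 ≤ ε * (X₁ * D * P₂) := by positivity
  have n4 : 0 ≤ X₁ * D * G := by positivity
  have n5 : 0 ≤ ℓ * (X₁ * M₁) := by positivity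
  have n6 : 0 ≤ ℓ * (X₁ * D * M₂) := by positivity
  have n8 : 0 ≤ D * M₄ := by positivity
  have eS : S = ε * (X₁ * D) + ε * (X₁ * P₁) + ε * (X₁ * D * P₂) + X₁ * D * G + ℓ * (X₁ * M₁)
      + ℓ * (X₁ * D * M₂) + M₃ + D * M₄ := by rw [hS]; ring
  have m1 : ε * (X₁ * D) ≤ S := by rw [eS]; linarith
  have m2 : ε * (X₁ * P₁) ≤ S := by rw [eS]; linarith
  have m3 : ε * (X₁ * D * P₂) ≤ S := by rw [eS]; linarith
  have m4 : X₁ * D * G ≤ S := by rw [eS]; linarith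
  have m5 : ℓ * (X₁ * M₁) ≤ S := by rw [eS]; linarith
  have m6 : ℓ * (X₁ * D * M₂) ≤ S := by rw [eS]; linarith
  have m7 : M₃ ≤ S := by rw [eS]; linarith
  have m8 : D * M₄ ≤ S := by rw [eS]; linarith
  have hS0 : 0 ≤ S := le_trans hM₃0 m7
  -- the low piece
  have sL : (D : ℝ) / E * (N' * (2 + 1 / (2 * Δ) + Real.pi / 2) + Real.pi * N) * Λ₀ ≤ kL * S := by
    have h1 : N' * (2 + 1 / (2 * Δ) + Real.pi / 2) + Real.pi * N ≤ X₁ * (4 * ca + 3 * Real.pi) := by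
      have p1 := mul_le_mul_of_nonneg_right hN'4 hca0
      have p2 := mul_le_mul_of_nonneg_left hN3 hpi
      rw [hca] at p1 ⊢
      linarith
    have h2 : (D : ℝ) / E * (N' * (2 + 1 / (2 * Δ) + Real.pi / 2) + Real.pi * N) * Λ₀
        ≤ (D : ℝ) / E * (X₁ * (4 * ca + 3 * Real.pi)) * Λ₀ :=
      mul_le_mul_of_nonneg_right (mul_le_mul_of_nonneg_left h1 (by positivity)) hΛ₀0
    have h3 : (D : ℝ) / E * (X₁ * (4 * ca + 3 * Real.pi)) * Λ₀
        = (4 * ca + 3 * Real.pi) * (ε * (X₁ * D) + C * (X₁ * D * G)) := by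
      rw [hΛ₀, show ε * (E : ℝ) + C * Eσ * M₁ = (ε + C * G) * E by rw [mul_assoc C, hσM]; ring]
      field_simp
    rw [h3] at h2
    refine h2.trans ?_
    have h4 := mul_le_mul_of_nonneg_left m4 hC0
    have h5 := mul_le_mul_of_nonneg_left (add_le_add m1 h4) (by positivity : (0 : ℝ) ≤ 4 * ca + 3 * Real.pi)
    refine h5.trans (le_of_eq ?_)
    rw [hkL]; ring
  -- the middle piece, harmonic part
  have sM : ((D : ℝ) / 2 + (((D : ℝ) / (2 * Δ) + Real.pi / 8 * (N * V + 4 * D) + D / 2))) * Λ₁ ≤ kM * S := by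
    have h1 : (D : ℝ) / 2 + (((D : ℝ) / (2 * Δ) + Real.pi / 8 * (N * V + 4 * D) + D / 2))
        ≤ X₁ * (cb + 3 * Real.pi * V₀ / 8) + 3 * Real.pi / 8 * (X₁ * D) * (K₂ / y) := by
      have hNV : N * V ≤ 3 * X₁ * Vb := mul_le_mul hN3 hVVb hV0 (by positivity)
      have e1 : (D : ℝ) / 2 + (((D : ℝ) / (2 * Δ) + Real.pi / 8 * (N * V + 4 * D) + D / 2))
          = D * cb + Real.pi / 8 * (N * V) := by rw [hcb]; ring
      have e2 : X₁ * (cb + 3 * Real.pi * V₀ / 8) + 3 * Real.pi / 8 * (X₁ * D) * (K₂ / y)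
          = X₁ * cb + Real.pi / 8 * (3 * X₁ * Vb) := by rw [hVb]; field_simp; ring
      rw [e1, e2]
      have p1 := mul_le_mul_of_nonneg_right hDX₁ hcb0
      have p2 := mul_le_mul_of_nonneg_left hNV (by positivity : (0 : ℝ) ≤ Real.pi / 8)
      linarith
    have h2 := mul_le_mul_of_nonneg_right h1 hΛ₁0
    refine h2.trans ?_
    have e3 : (X₁ * (cb + 3 * Real.pi * V₀ / 8) + 3 * Real.pi / 8 * (X₁ * D) * (K₂ / y)) * Λ₁
        = 8 * (cb + 3 * Real.pi * V₀ / 8) * (ε * (X₁ * P₁)) + (cb + 3 * Real.pi * V₀ / 8) * C * (ℓ * (X₁ * M₁))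
          + 3 * Real.pi * K₂ * (ε * (X₁ * D * (P₁ / y))) + 3 * Real.pi * K₂ * C / 8 * (ℓ * (X₁ * D * (M₁ / y))) := by
      rw [hΛ₁]; field_simp; ring
    rw [e3, hyP, hy1]
    have e4 : 3 * Real.pi * K₂ * (ε * (X₁ * D * (P₂ / c₀))) = 3 * Real.pi * K₂ / c₀ * (ε * (X₁ * D * P₂)) := by
      field_simp
    have e5 : 3 * Real.pi * K₂ * C / 8 * (ℓ * (X₁ * D * (M₂ / c₀)))
        = 3 * Real.pi * K₂ * C / (8 * c₀) * (ℓ * (X₁ * D * M₂)) := by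
      field_simp
    rw [e4, e5]
    have hk1 : 0 ≤ 8 * (cb + 3 * Real.pi * V₀ / 8) := by positivity
    have hk2 : 0 ≤ (cb + 3 * Real.pi * V₀ / 8) * C := by positivity
    have hk3 : 0 ≤ 3 * Real.pi * K₂ / c₀ := by positivity
    have hk4 : 0 ≤ 3 * Real.pi * K₂ * C / (8 * c₀) := by positivity
    have a1 := mul_le_mul_of_nonneg_left m2 hk1
    have a2 := mul_le_mul_of_nonneg_left m5 hk2
    have a3 := mul_le_mul_of_nonneg_left m3 hk3
    have a4 := mul_le_mul_of_nonneg_left m6 hk4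
    have e6 : kM * S = 8 * (cb + 3 * Real.pi * V₀ / 8) * S + (cb + 3 * Real.pi * V₀ / 8) * C * S
        + 3 * Real.pi * K₂ / c₀ * S + 3 * Real.pi * K₂ * C / (8 * c₀) * S := by rw [hkM]; ring
    rw [e6]
    exact add_le_add (add_le_add (add_le_add a1 a2) a3) a4
  -- the middle piece, plain part
  have sN : Real.pi ^ 2 * D * N' / 4 * Λ₂ / (E : ℝ) ^ 2 ≤ kN * S := by
    have h1 : Real.pi ^ 2 * D * N' / 4 * Λ₂ / (E : ℝ) ^ 2 ≤ Real.pi ^ 2 * D * X₁ * (Λ₂ / (E : ℝ) ^ 2) := by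
      rw [← mul_div_assoc]
      apply div_le_div_of_nonneg_right _ (by positivity)
      apply mul_le_mul_of_nonneg_right _ hΛ₂0
      have := mul_le_mul_of_nonneg_left hN'4 (by positivity : (0 : ℝ) ≤ Real.pi ^ 2 * D)
      linarith
    have h2 : Λ₂ / (E : ℝ) ^ 2 ≤ ε + C * G := by
      rw [div_le_iff₀ (by positivity), hΛ₂]
      have t1 : ε * (E : ℝ) ≤ ε * (E : ℝ) ^ 2 := by
        apply mul_le_mul_of_nonneg_left _ hε.le
        rw [sq]; exact le_mul_of_one_le_right hE0.le hE1r
      have t2 : C * Eθ * M₁ ≤ C * (G * (E : ℝ) ^ 2) := by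
        rw [mul_assoc]; exact mul_le_mul_of_nonneg_left hθM hC0
      linarith
    have h3 := mul_le_mul_of_nonneg_left h2 (by positivity : 0 ≤ Real.pi ^ 2 * D * X₁)
    refine (h1.trans h3).trans ?_
    have h4 := mul_le_mul_of_nonneg_left m4 hC0
    have h5 := mul_le_mul_of_nonneg_left (add_le_add m1 h4) (by positivity : (0 : ℝ) ≤ Real.pi ^ 2)
    have e6 : Real.pi ^ 2 * D * X₁ * (ε + C * G) = Real.pi ^ 2 * (ε * (X₁ * D) + C * (X₁ * D * G)) := by ring
    rw [e6]
    refine h5.trans (le_of_eq ?_)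
    rw [hkN]; ring
  -- the tail
  have sT : V * (E' : ℝ) ^ 2 * R / (4 * ((H : ℝ) + 1)) ≤ kT * S := by
    have s3 : V * (E' : ℝ) ^ 2 * R / (4 * ((H : ℝ) + 1)) ≤ Vb * (4 * R₀ * M₃) := by
      have hR0 : 0 ≤ R := sum_nonneg fun e _ => by positivity
      have hRR₀ : R ≤ R₀ := hR₀ E E' hE1 hEE' hE'2
      have hE'r : (E' : ℝ) ≤ 2 * E := by exact_mod_cast hE'2
      have hθpos : 0 < (E : ℝ) ^ θ := Real.rpow_pos_of_pos hE0 θ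
      have hM₃eq : M₃ * (E : ℝ) ^ θ = (E : ℝ) ^ 2 := by
        rw [hM₃, ← Real.rpow_add hE0, sub_add_cancel, Real.rpow_two]
      calc V * (E' : ℝ) ^ 2 * R / (4 * ((H : ℝ) + 1))
          ≤ Vb * (2 * E) ^ 2 * R₀ / (4 * ((H : ℝ) + 1)) := by
            apply div_le_div_of_nonneg_right _ (by positivity)
            gcongr
        _ ≤ Vb * (2 * E) ^ 2 * R₀ / (E : ℝ) ^ θ :=
            div_le_div_of_nonneg_left (by positivity) hθpos hH4
        _ = Vb * (4 * R₀ * M₃) := by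
            rw [div_eq_iff hθpos.ne',
              show Vb * (4 * R₀ * M₃) * (E : ℝ) ^ θ = Vb * 4 * R₀ * (M₃ * (E : ℝ) ^ θ) by ring, hM₃eq]
            ring
    refine s3.trans ?_
    have e1 : Vb * (4 * R₀ * M₃) = 4 * R₀ * V₀ * M₃ + 4 * R₀ * K₂ * (D * (M₃ / y)) := by
      rw [hVb]; field_simp
    rw [e1, hy3, show 4 * R₀ * K₂ * (D * (M₄ / c₀)) = 4 * R₀ * K₂ / c₀ * (D * M₄) by field_simp]
    have a1 := mul_le_mul_of_nonneg_left m7 (by positivity : (0 : ℝ) ≤ 4 * R₀ * V₀)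
    have a2 := mul_le_mul_of_nonneg_left m8 (by positivity : (0 : ℝ) ≤ 4 * R₀ * K₂ / c₀)
    have e2 : kT * S = 4 * R₀ * V₀ * S + 4 * R₀ * K₂ / c₀ * S := by rw [hkT]; ring
    rw [e2]
    exact add_le_add a1 a2
  have hfin : 2 * (kL * S + kM * S + kN * S) + kT * S = (2 * (kL + kM + kN) + kT) * S := by ring
  linarith [sL, sM, sN, sT, hfin]

end Summit.Parity.BatemanHorn.Theorems
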